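import Mathlib
import Summits.BirchSwinnertonDyer.BirchSwinnertonDyer.Theorems.KatoDescentTamePotSupersingularTameLowerFibreAdjointBricksFive
import Summits.BirchSwinnertonDyer.BirchSwinnertonDyer.Theorems.KatoDescentTamePotSupersingularTameLowerFibreAdjointBricksFiveDual

/-!
# Bricks for the `GL₂(𝔽₅)`-lifting route (T5′), VIII: the square-zero layer `𝔽₅[ε] → 𝔽₅`

Continuation of `…TameLowerFibreAdjointBricksFive*` (same namespace). ARM-P audit r07 S7 ADDENDUM-1 §C
proves the lifting statement (T5′) (a closed `G ≤ GL₂(A)` with residual image `GL₂(𝔽₅)` contains a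
conjugate of `SL₂(W_A)`) through the Artinian kernel (P′), one small surjection `A → B` at a time. Files
V–VI are the kernel theorem for the UNRAMIFIED layers `ℤ/5^{m+1} → ℤ/5^m` (conjugator `u = 1`). This file
is the kernel theorem for the simplest layer of the OTHER kind — equal characteristic, conjugator
`u ≠ 1` in general — named as the first target in HOME/k8t-c2/g14 §4:
`exists_conj_le_of_forall_exists_map_fst_eq`: **every subgroup of `GL₂(𝔽₅[ε])` whose reduction covers
`GL₂(𝔽₅)` contains `u GL₂(𝔽₅) u⁻¹` for some `u ≡ 1 (mod ε)`** (so a conjugate of `SL₂(𝔽₅)`). At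
`(n, k) = (2, 𝔽₅)` this is exactly what FAILS for residual image `SL₂(𝔽₅)` ([M] = Manoharmayum 2015,
Remark 4.4: the subgroup `{(1 + εξ(A))A : A ∈ SL₂(𝔽₅)}`, `ξ` a non-trivial cocycle), and what the
variant route (C3) repairs with the residual image `GL₂(𝔽₅)`: inputs `H¹(GL₂(𝔽₅), 𝔰𝔩₂(𝔽₅)) = 0`
(p532773), `Hom(GL₂(𝔽₅), 𝔽₅) = 0` and the dual-number calculus (file VII), [M] Lemma 3.3
(`traceless_submodule_eq_bot_or_top`) and `M₂^{SL₂} = scalars` (`eq_scalar_of_commute_transvections`,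
file I). No cohomology library: cocycles are functions, the argument is the explicit one of (C3)(g)
(Prop. 2.2 (iii)) written out. Route-free, no definitions, nothing about elliptic curves or items
19618/19981 (open). Target T-S7r07-1 (`FibreLatticeInput 5`).
-/

set_option linter.dupNamespace false

open Matrix TrivSqZeroExt

namespace Summit.BirchSwinnertonDyer.BirchSwinnertonDyer.Theorems.GL2F5AdjointBricks

section duallayer

/-- **The square-zero layer `𝔽₅[ε] → 𝔽₅` of (P′) in the kernel.** Every subgroup `H ≤ GL₂(𝔽₅[ε])`
whose reduction modulo `ε` covers `GL₂(𝔽₅)` contains a conjugate `u GL₂(𝔽₅) u⁻¹` of the constant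
subgroup `GL₂(𝔽₅) ⊂ GL₂(𝔽₅[ε])` by an element `u ≡ 1 (mod ε)` — in particular a conjugate of
`SL₂(𝔽₅)`. This is the `(2, 𝔽₅)` case that [M] Remark 4.4 shows to FAIL for residual image
`SL₂(𝔽₅)` (the subgroup `{(1 + εξ(A))A}`); with residual image `GL₂(𝔽₅)` it holds because
`H¹(GL₂(𝔽₅), 𝔰𝔩₂(𝔽₅)) = 0` (p532773) and `Hom(GL₂(𝔽₅), 𝔽₅) = 0` (`GL2F5_addChar_eq_zero`): the
kernel `N̄ = {X : 1 + εX ∈ H}` is a `GL₂(𝔽₅)`-stable subspace of `M₂(𝔽₅)`; the `ε`-parts `c(q)` of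
chosen lifts form a cocycle modulo `N̄`; its trace is killed (either scalars lie in `N̄`, or `N̄` is
trace-free and `tr ∘ c` is an additive character); then either `𝔰𝔩₂ ⊆ N̄` (and `u = 1`) or
`N̄ ∩ 𝔰𝔩₂ = 0` ([M] Lemma 3.3, `traceless_submodule_eq_bot_or_top`), the trace-free `c` is an honest
cocycle, `c(q) = q m q⁻¹ − m`, and `u = 1 − εm`. -/
theorem exists_conj_le_of_forall_exists_map_fst_eq (H : Subgroup (GL (Fin 2) (DualNumber (ZMod 5))))
    (hsurj : ∀ q : GL (Fin 2) (ZMod 5), ∃ h ∈ H,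
      Matrix.GeneralLinearGroup.map (TrivSqZeroExt.fstHom (ZMod 5) (ZMod 5) (ZMod 5)).toRingHom h = q) :
    ∃ u : GL (Fin 2) (DualNumber (ZMod 5)),
      Matrix.GeneralLinearGroup.map (TrivSqZeroExt.fstHom (ZMod 5) (ZMod 5) (ZMod 5)).toRingHom u = 1 ∧
      ∀ q : GL (Fin 2) (ZMod 5),
        u * Matrix.GeneralLinearGroup.map (TrivSqZeroExt.inlHom (ZMod 5) (ZMod 5)) q * u⁻¹ ∈ H := by
  classical
  have h25 : (2 : ZMod 5) ≠ 0 := by decide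
  have h35 : (3 : ZMod 5) ≠ 0 := by decide
  -- the transvections as elements of `GL₂(𝔽₅)` (before `𝔽₅` is used as a field)
  set uG : GL (Fin 2) (ZMod 5) := ⟨!![1, 1; 0, 1], !![1, -1; 0, 1], by decide, by decide⟩ with uG_def
  set vG : GL (Fin 2) (ZMod 5) := ⟨!![1, 0; 1, 1], !![1, 0; -1, 1], by decide, by decide⟩ with vG_def
  have huGval : uG.val = !![1, 1; 0, 1] := rfl
  have huGinv : (uG⁻¹).val = !![1, -1; 0, 1] := rfl
  have hvGval : vG.val = !![1, 0; 1, 1] := rfl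
  have hvGinv : (vG⁻¹).val = !![1, 0; -1, 1] := rfl
  have hu'u : (!![1, -1; 0, 1] : Matrix (Fin 2) (Fin 2) (ZMod 5)) * !![1, 1; 0, 1] = 1 := by decide
  have hv'v : (!![1, 0; -1, 1] : Matrix (Fin 2) (Fin 2) (ZMod 5)) * !![1, 0; 1, 1] = 1 := by decide
  set ρ := Matrix.GeneralLinearGroup.map (n := Fin 2)
    (TrivSqZeroExt.fstHom (ZMod 5) (ZMod 5) (ZMod 5)).toRingHom with hρ
  set ι := Matrix.GeneralLinearGroup.map (n := Fin 2) (TrivSqZeroExt.inlHom (ZMod 5) (ZMod 5)) with hι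
  -- values of `ρ`, `ι`
  have hρval : ∀ h : GL (Fin 2) (DualNumber (ZMod 5)),
      (ρ h).val = (h.val).map TrivSqZeroExt.fst := by
    intro h; ext i j; rfl
  have hιval : ∀ q : GL (Fin 2) (ZMod 5), (ι q).val = (q.val).map TrivSqZeroExt.inl := fun q => rfl
  have hρι : ∀ q, ρ (ι q) = q := by
    intro q; apply Units.ext; rw [hρval, hιval, map_fst_map_inl]
  -- the kernel elements `τ X = 1 + εX`
  let τ : Matrix (Fin 2) (Fin 2) (ZMod 5) → GL (Fin 2) (DualNumber (ZMod 5)) := fun X =>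
    ⟨1 + X.map TrivSqZeroExt.inr, 1 - X.map TrivSqZeroExt.inr,
      one_add_map_inr_mul_one_sub_map_inr X, one_sub_map_inr_mul_one_add_map_inr X⟩
  have hτval : ∀ X, (τ X).val = 1 + X.map TrivSqZeroExt.inr := fun X => rfl
  have hτadd : ∀ X Y, τ (X + Y) = τ X * τ Y := by
    intro X Y; apply Units.ext
    rw [Units.val_mul, hτval, hτval, hτval, one_add_map_inr_mul_one_add_map_inr]
  have hτzero : τ 0 = 1 := by
    apply Units.ext; rw [hτval, Units.val_one]
    have : (0 : Matrix (Fin 2) (Fin 2) (ZMod 5)).map (TrivSqZeroExt.inr : ZMod 5 → DualNumber (ZMod 5)) = 0 := by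
      ext i j <;> simp
    rw [this, add_zero]
  have hτneg : ∀ X, τ (-X) = (τ X)⁻¹ := by
    intro X; apply eq_inv_of_mul_eq_one_left; rw [← hτadd, neg_add_cancel, hτzero]
  have hτsub : ∀ X Y, τ (X - Y) = τ X * (τ Y)⁻¹ := by
    intro X Y; rw [sub_eq_add_neg, hτadd, hτneg]
  have hτcomm : ∀ X Y, τ X * τ Y = τ Y * τ X := by
    intro X Y; rw [← hτadd, ← hτadd, add_comm]
  have hρτ : ∀ X, ρ (τ X) = 1 := by
    intro X; apply Units.ext; rw [hρval, hτval, map_fst_one_add_map_inr, Units.val_one]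
  -- conjugation acts through `ρ`
  have hconj : ∀ (h : GL (Fin 2) (DualNumber (ZMod 5))) (X : Matrix (Fin 2) (Fin 2) (ZMod 5)),
      h * τ X * h⁻¹ = τ ((ρ h).val * X * ((ρ h)⁻¹).val) := by
    intro h X
    apply Units.ext
    rw [Units.val_mul, Units.val_mul, hτval, hτval, ← map_inv, hρval, hρval]
    exact mul_one_add_map_inr_mul _ _ X (by rw [← Units.val_mul, mul_inv_cancel, Units.val_one])
  -- the kernel of `ρ` consists of the `τ X`
  have hK : ∀ k : GL (Fin 2) (DualNumber (ZMod 5)), ρ k = 1 → k = τ ((k.val).map TrivSqZeroExt.snd) := by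
    intro k hk
    apply Units.ext
    rw [hτval]
    apply eq_one_add_map_inr_of_map_fst_eq_one
    rw [← hρval, hk, Units.val_one]
  -- chosen lifts
  choose s hsH hsρ using hsurj
  -- the subspace `N̄ = {X : τ X ∈ H}` and its trace-zero part
  let Nbar : Submodule (ZMod 5) (Matrix (Fin 2) (Fin 2) (ZMod 5)) :=
    { carrier := {X | τ X ∈ H}
      add_mem' := by
        intro X X' hX hX'
        show τ (X + X') ∈ H
        rw [hτadd]; exact H.mul_mem hX hX'
      zero_mem' := by show τ 0 ∈ H; rw [hτzero]; exact H.one_mem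
      smul_mem' := by
        intro a X hX
        show τ (a • X) ∈ H
        have ha : a • X = a.val • X := by
          rw [← ZMod.natCast_zmod_val a, Nat.cast_smul_eq_nsmul]; simp
        rw [ha]
        induction a.val with
        | zero => rw [zero_smul, hτzero]; exact H.one_mem
        | succ n ih => rw [succ_nsmul, hτadd]; exact H.mul_mem ih hX }
  have hNmem : ∀ X, X ∈ Nbar ↔ τ X ∈ H := fun X => Iff.rfl
  have hNconj : ∀ (q : GL (Fin 2) (ZMod 5)), ∀ X ∈ Nbar, q.val * X * (q⁻¹).val ∈ Nbar := by
    intro q X hX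
    rw [hNmem] at hX ⊢
    have h := hconj (s q) X
    rw [hsρ] at h
    rw [← h]; exact H.mul_mem (H.mul_mem (hsH q) hX) (H.inv_mem (hsH q))
  let N0 : Submodule (ZMod 5) (Matrix (Fin 2) (Fin 2) (ZMod 5)) :=
    Nbar ⊓ LinearMap.ker (Matrix.traceLinearMap (Fin 2) (ZMod 5) (ZMod 5))
  have hN0 : ∀ X, X ∈ N0 ↔ τ X ∈ H ∧ Matrix.trace X = 0 := fun X => by
    rw [Submodule.mem_inf, hNmem, LinearMap.mem_ker]; rfl
  haveI : Fact (Nat.Prime 5) := ⟨by norm_num⟩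
  have htr_conj : ∀ (q : GL (Fin 2) (ZMod 5)) (X : Matrix (Fin 2) (Fin 2) (ZMod 5)),
      Matrix.trace (q.val * X * (q⁻¹).val) = Matrix.trace X := by
    intro q X
    rw [Matrix.trace_mul_cycle, ← Units.val_mul, inv_mul_cancel, Units.val_one, Matrix.one_mul]
  have hN0tr : ∀ X ∈ N0, Matrix.trace X = 0 := fun X hX => ((hN0 X).1 hX).2
  have hN0u : ∀ X ∈ N0, !![1, 1; 0, 1] * X * !![1, -1; 0, 1] ∈ N0 := by
    intro X hX
    obtain ⟨hXH, hXtr⟩ := (hN0 X).1 hX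
    have h := hNconj uG X ((hNmem X).2 hXH)
    have ht := htr_conj uG X
    rw [huGval, huGinv, hXtr] at ht
    rw [huGval, huGinv] at h
    exact (hN0 _).2 ⟨(hNmem _).1 h, ht⟩
  have hN0v : ∀ X ∈ N0, !![1, 0; 1, 1] * X * !![1, 0; -1, 1] ∈ N0 := by
    intro X hX
    obtain ⟨hXH, hXtr⟩ := (hN0 X).1 hX
    have h := hNconj vG X ((hNmem X).2 hXH)
    have ht := htr_conj vG X
    rw [hvGval, hvGinv, hXtr] at ht
    rw [hvGval, hvGinv] at h
    exact (hN0 _).2 ⟨(hNmem _).1 h, ht⟩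
  have dich := traceless_submodule_eq_bot_or_top (F := ZMod 5) h25 N0 hN0tr hN0u hN0v
  -- if the scalars are not in `N̄`, then `N̄` is trace-free
  have hT : (1 : Matrix (Fin 2) (Fin 2) (ZMod 5)) ∉ Nbar → ∀ X ∈ Nbar, Matrix.trace X = 0 := by
    intro h1 X hX
    by_contra htr
    apply h1
    rcases dich with hbot | htop
    · -- `N̄ ∩ 𝔰𝔩₂ = 0`: `X` commutes with the transvections, hence is a non-zero scalar
      have hcu : !![1, 1; 0, 1] * X * !![1, -1; 0, 1] - X = 0 := by
        have h1 := Nbar.sub_mem (hNconj uG X hX) hX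
        have h2 := htr_conj uG X
        rw [huGval, huGinv] at h1 h2
        have hm : !![1, 1; 0, 1] * X * !![1, -1; 0, 1] - X ∈ N0 :=
          (hN0 _).2 ⟨(hNmem _).1 h1, by rw [Matrix.trace_sub, sub_eq_zero]; exact h2⟩
        rw [hbot] at hm; exact (Submodule.mem_bot (R := ZMod 5)).1 hm
      have hcv : !![1, 0; 1, 1] * X * !![1, 0; -1, 1] - X = 0 := by
        have h1 := Nbar.sub_mem (hNconj vG X hX) hX
        have h2 := htr_conj vG X
        rw [hvGval, hvGinv] at h1 h2
        have hm : !![1, 0; 1, 1] * X * !![1, 0; -1, 1] - X ∈ N0 :=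
          (hN0 _).2 ⟨(hNmem _).1 h1, by rw [Matrix.trace_sub, sub_eq_zero]; exact h2⟩
        rw [hbot] at hm; exact (Submodule.mem_bot (R := ZMod 5)).1 hm
      have hu : !![1, 1; 0, 1] * X = X * !![1, 1; 0, 1] := by
        have h := sub_eq_zero.1 hcu
        calc !![1, 1; 0, 1] * X = !![1, 1; 0, 1] * X * (!![1, -1; 0, 1] * !![1, 1; 0, 1]) := by
              rw [hu'u, Matrix.mul_one]
          _ = (!![1, 1; 0, 1] * X * !![1, -1; 0, 1]) * !![1, 1; 0, 1] := by
              simp only [Matrix.mul_assoc]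
          _ = X * !![1, 1; 0, 1] := by rw [h]
      have hv : !![1, 0; 1, 1] * X = X * !![1, 0; 1, 1] := by
        have h := sub_eq_zero.1 hcv
        calc !![1, 0; 1, 1] * X = !![1, 0; 1, 1] * X * (!![1, 0; -1, 1] * !![1, 0; 1, 1]) := by
              rw [hv'v, Matrix.mul_one]
          _ = (!![1, 0; 1, 1] * X * !![1, 0; -1, 1]) * !![1, 0; 1, 1] := by
              simp only [Matrix.mul_assoc]
          _ = X * !![1, 0; 1, 1] := by rw [h]
      have hscal := eq_scalar_of_commute_transvections X hu hv
      set a : ZMod 5 := X 0 0 with ha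
      have ha0 : a ≠ 0 := by
        intro h0
        apply htr
        rw [hscal, h0, zero_smul, Matrix.trace_zero]
      have h1' : (1 : Matrix (Fin 2) (Fin 2) (ZMod 5)) = a⁻¹ • X := by
        rw [hscal, smul_smul, inv_mul_cancel₀ ha0, one_smul]
      rw [h1']; exact Nbar.smul_mem _ hX
    · -- `𝔰𝔩₂ ⊆ N̄`: the trace-free part of `X` lies in `N̄`, hence so does its scalar part
      have hX0 : X - (3 * Matrix.trace X) • (1 : Matrix (Fin 2) (Fin 2) (ZMod 5)) ∈ Nbar := by
        refine ((hN0 _).1 (htop _ ?_)).1 |> (hNmem _).2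
        simp only [Matrix.trace_sub, Matrix.trace_smul, Matrix.trace_one, Fintype.card_fin, smul_eq_mul]
        ring_nf
        reduce_mod_char
      have hsc : (3 * Matrix.trace X) • (1 : Matrix (Fin 2) (Fin 2) (ZMod 5)) ∈ Nbar := by
        have := Nbar.sub_mem hX hX0
        rwa [sub_sub_cancel] at this
      have hne : (3 * Matrix.trace X : ZMod 5) ≠ 0 := mul_ne_zero h35 htr
      have h1' : (1 : Matrix (Fin 2) (Fin 2) (ZMod 5)) = (3 * Matrix.trace X)⁻¹ • ((3 * Matrix.trace X) • 1) := by
        rw [smul_smul, inv_mul_cancel₀ hne, one_smul]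
      rw [h1']; exact Nbar.smul_mem _ hsc
  -- the `ε`-parts of the lifts, and the cocycle defect
  let c : GL (Fin 2) (ZMod 5) → Matrix (Fin 2) (Fin 2) (ZMod 5) := fun q =>
    ((s q * (ι q)⁻¹).val).map TrivSqZeroExt.snd
  have hsc : ∀ q, s q = τ (c q) * ι q := by
    intro q
    have hk : ρ (s q * (ι q)⁻¹) = 1 := by rw [map_mul, map_inv, hsρ, hρι, mul_inv_cancel]
    have h := hK _ hk
    rw [← h, inv_mul_cancel_right]
  have hD : ∀ (e : GL (Fin 2) (ZMod 5) → Matrix (Fin 2) (Fin 2) (ZMod 5))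
      (S : GL (Fin 2) (ZMod 5) → GL (Fin 2) (DualNumber (ZMod 5))),
      (∀ q, S q = τ (e q) * ι q) →
      ∀ q q', S q * S q' * (S (q * q'))⁻¹ = τ (e q + q.val * e q' * (q⁻¹).val - e (q * q')) := by
    intro e S hS q q'
    have h1 : ι q * τ (e q') = τ (q.val * e q' * (q⁻¹).val) * ι q := by
      have h := hconj (ι q) (e q'); rw [hρι] at h
      rw [← h, inv_mul_cancel_right]
    rw [hS q, hS q', hS (q * q'), map_mul, hτsub, hτadd]
    calc τ (e q) * ι q * (τ (e q') * ι q') * (τ (e (q * q')) * (ι q * ι q'))⁻¹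
        = τ (e q) * (ι q * τ (e q')) * ι q' * (ι q * ι q')⁻¹ * (τ (e (q * q')))⁻¹ := by group
      _ = τ (e q) * (τ (q.val * e q' * (q⁻¹).val) * ι q) * ι q' * (ι q * ι q')⁻¹ *
            (τ (e (q * q')))⁻¹ := by rw [h1]
      _ = τ (e q) * τ (q.val * e q' * (q⁻¹).val) * (τ (e (q * q')))⁻¹ := by group
  -- the trace of `c` is corrected away
  let t : GL (Fin 2) (ZMod 5) → ZMod 5 := fun q => 3 * Matrix.trace (c q)
  have hS1 : ∀ q, τ (t q • (1 : Matrix (Fin 2) (Fin 2) (ZMod 5))) ∈ H := by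
    intro q
    by_cases h1 : (1 : Matrix (Fin 2) (Fin 2) (ZMod 5)) ∈ Nbar
    · exact (hNmem _).1 (Nbar.smul_mem (t q) h1)
    · have hadd : ∀ q q' : GL (Fin 2) (ZMod 5),
          Matrix.trace (c (q * q')) = Matrix.trace (c q) + Matrix.trace (c q') := by
        intro q q'
        have hmem : c q + q.val * c q' * (q⁻¹).val - c (q * q') ∈ Nbar := by
          rw [hNmem, ← hD c s hsc q q']
          exact H.mul_mem (H.mul_mem (hsH q) (hsH q')) (H.inv_mem (hsH _))
        have h0 := hT h1 _ hmem
        rw [Matrix.trace_sub, Matrix.trace_add, htr_conj] at h0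
        linear_combination -h0
      have hzero := GL2F5_addChar_eq_zero (fun q => Matrix.trace (c q)) hadd q
      have ht0 : t q = 0 := by show 3 * Matrix.trace (c q) = 0; rw [hzero, mul_zero]
      rw [ht0, zero_smul, hτzero]; exact H.one_mem
  let c' : GL (Fin 2) (ZMod 5) → Matrix (Fin 2) (Fin 2) (ZMod 5) := fun q => c q - t q • 1
  let s' : GL (Fin 2) (ZMod 5) → GL (Fin 2) (DualNumber (ZMod 5)) := fun q => (τ (t q • 1))⁻¹ * s q
  have hs'H : ∀ q, s' q ∈ H := fun q => H.mul_mem (H.inv_mem (hS1 q)) (hsH q)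
  have hs'c : ∀ q, s' q = τ (c' q) * ι q := by
    intro q
    show (τ (t q • 1))⁻¹ * s q = τ (c q - t q • 1) * ι q
    rw [hsc, hτsub, ← mul_assoc, ← hτneg, hτcomm]
  have hc'tr : ∀ q, Matrix.trace (c' q) = 0 := by
    intro q
    show Matrix.trace (c q - (3 * Matrix.trace (c q)) • (1 : Matrix (Fin 2) (Fin 2) (ZMod 5))) = 0
    simp only [Matrix.trace_sub, Matrix.trace_smul, Matrix.trace_one, Fintype.card_fin, smul_eq_mul]
    ring_nf
    reduce_mod_char
  have hδ : ∀ q q', c' q + q.val * c' q' * (q⁻¹).val - c' (q * q') ∈ N0 := by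
    intro q q'
    refine (hN0 _).2 ⟨?_, ?_⟩
    · rw [← hD c' s' hs'c q q']
      exact H.mul_mem (H.mul_mem (hs'H q) (hs'H q')) (H.inv_mem (hs'H _))
    · rw [Matrix.trace_sub, Matrix.trace_add, htr_conj, hc'tr, hc'tr, hc'tr, add_zero, sub_zero]
  -- conclusion
  rcases dich with hbot | htop
  · -- `N̄ ∩ 𝔰𝔩₂ = 0`: `c'` is an honest trace-free cocycle, hence a coboundary; conjugate by `1 - εm`
    have hcoc : ∀ q q' : GL (Fin 2) (ZMod 5), c' (q * q') = c' q + q.val * c' q' * (q⁻¹).val := by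
      intro q q'
      have h := hδ q q'
      rw [hbot] at h
      exact (sub_eq_zero.1 ((Submodule.mem_bot (R := ZMod 5)).1 h)).symm
    obtain ⟨m₀, -, hm₀⟩ := GL2F5AdjointH1.exists_traceless_eq_coboundary c' hcoc hc'tr
    refine ⟨τ (-m₀), hρτ _, fun q => ?_⟩
    have h1 : ι q * τ m₀ = τ (q.val * m₀ * (q⁻¹).val) * ι q := by
      have h := hconj (ι q) m₀; rw [hρι] at h
      rw [← h, inv_mul_cancel_right]
    have hkey : τ (-m₀) * ι q * (τ (-m₀))⁻¹ = s' q := by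
      rw [hs'c, hm₀ q, ← hτneg, neg_neg, mul_assoc, h1, ← mul_assoc, ← hτadd,
        show -m₀ + q.val * m₀ * (q⁻¹).val = q.val * m₀ * (q⁻¹).val - m₀ by abel]
    rw [hkey]; exact hs'H q
  · -- `𝔰𝔩₂ ⊆ N̄`: `τ (c' q) ∈ H`, so `ι q ∈ H`
    refine ⟨1, map_one ρ, fun q => ?_⟩
    rw [one_mul, inv_one, mul_one]
    have hτc : τ (c' q) ∈ H := ((hN0 _).1 (htop (c' q) (hc'tr q))).1
    have hq : ι q = (τ (c' q))⁻¹ * s' q := by rw [hs'c, inv_mul_cancel_left]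
    rw [hq]; exact H.mul_mem (H.inv_mem hτc) (hs'H q)

end duallayer

end Summit.BirchSwinnertonDyer.BirchSwinnertonDyer.Theorems.GL2F5AdjointBricks
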